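import Summits.BirchSwinnertonDyer.BirchSwinnertonDyer.Theorems.GenusKolyvaginAtTwoKolyvaginRelationAtTwo

/-!
# Route `GenusKolyvaginAtTwo`, item stmt-BirchSwinnertonDyer-24880 `KolyvaginRelationAtTwo` (Q2):
# the REGISTERED stubs of its skeleton BY NAME — composition, projections, and both stubs modulo the
# ONE print fact (bookkeeping helper; seat `leafhand-bsd-genuskolyvaginattw-2` g0)

The registered skeleton of Q2 (`Q2_birth.lean`, sha `57eb060de6f1f376…`, planner bsd-idea-1 g3) splits the
route decl `KolyvaginRelationAtTwo` — McCallum 1991 Prop. 4.4 «in particular» at `p = 2`,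
`ord_λ d_M(mℓ) = ord_λ c_M(mℓ) = ord_λ c_M(m)` — into its two biconditionals:

* `stub_selmerVsTorsionAtEll` — at `v ∣ ℓ`, every `2^j c_M(mℓ)` is Selmer-local iff it is torsion-local
  (`ord_λ d_M(mℓ) = ord_λ c_M(mℓ)`; Kolyvagin Prop. 4.3 / McCallum (5.2) at `2`);
* `stub_levelChange` — `2^j c_M(mℓ)` is torsion-local at `v ∣ ℓ` iff `2^j c_M(m)` is
  (`ord_λ c_M(mℓ) = ord_λ c_M(m)`; Gross Prop. 3.7 (2) / 6.2 (2) at `2`).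

This file records, with the registered signatures VERBATIM:
1. `kolyvaginRelationAtTwo_of_stubs` — the skeleton's composition in the tree (Q2 BY NAME from the two
   registered stubs; the crux is their conjunction pointwise);
2. `stubSelmerVsTorsionAtEll_of_kolyvaginRelationAtTwo`, `stubLevelChange_of_kolyvaginRelationAtTwo` —
   the converse projections (each stub IS a conjunct of Q2: no stub is weaker or stronger than needed);
3. `stubSelmerVsTorsionAtEll_of_frobeniusCongruence`, `stubLevelChange_of_frobeniusCongruence` — BOTH
   registered stubs BY NAME modulo the single named print fact
   `GrossLMS1991.prop37_2_frobeniusCongruence` (Gross 1991 Prop. 3.7 (2) = Nekovář 2007 Prop. 4.9, the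
   Eichler–Shimura congruence for Heegner points; typed, PUBLISHED, unproved in the tree), through seat
   gk2-p2's conditional closer `GenusExact.kolyvaginRelationAtTwo_of_frobeniusCongruence` (p614530).

HONEST FRAMING. Items 3 are CONDITIONAL on that print fact (gate: `conditional-result`); nothing here
closes a stub or the item — the stubs close only when `prop37_2_frobeniusCongruence` (equivalently
`prop37_2_reductionCongruence_inert`) is discharged in the tree, at which point BOTH stubs and Q2 follow by
the one-liners below. Everything `2`-specific under Q2 is already a theorem (gk2-p2 g5–g7: eigenspace-free
`ker χ_ℓ`, Gross Lemma 4.3 at `2` under Q2's binders, concrete pair dictionary). No new mathematics; BSD is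
not proved by any of this. References: [McCallumLMS1991] §4 Prop. 4.4; [GrossLMS1991] Prop. 3.7 (2),
Prop. 6.2 (2); [Nekovar2007] Prop. 4.9.
-/

set_option autoImplicit false
set_option linter.dupNamespace false -- tree convention: `Summit.BirchSwinnertonDyer.BirchSwinnertonDyer.Theorems`

namespace Summit.BirchSwinnertonDyer.BirchSwinnertonDyer.Theorems.GenusExact.KolyvaginRelationAtTwoStubs

open Summit.BirchSwinnertonDyer.BirchSwinnertonDyer.Theses.GenusKolyvaginAtTwo
open Literature.NumberTheory.EllipticCurves Literature.NumberTheory.EllipticCurves.GrossLMS1991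

/-- **Q2 `KolyvaginRelationAtTwo` BY NAME from its two REGISTERED stubs** (skeleton `Q2_birth.lean`,
signatures verbatim): the crux is, pointwise in all its binders, the conjunction
`stub_selmerVsTorsionAtEll ∧ stub_levelChange`. [cite: McCallumLMS1991, §4 Prop. 4.4 «in particular»] -/
theorem kolyvaginRelationAtTwo_of_stubs
    (h₁ : ∀ (W : WeierstrassCurve ℚ) [W.IsElliptic] [W.IsGloballyMinimal] [NeZero (W.conductorNorm ℤ)], ¬ W.HasCM → ∀ (K : Type) [Field K] [NumberField K], Literature.NumberTheory.EllipticCurves.IsImaginaryQuadratic K → NumberField.discr K ≠ -3 → NumberField.discr K ≠ -4 → Literature.NumberTheory.EllipticCurves.SatisfiesHeegnerHypothesis (W.conductorNorm ℤ) K → (∀ n : ℕ, W.HasSurjectiveModNGaloisRep (2 ^ n : ℕ)) → ∀ (Dt : Literature.NumberTheory.EllipticCurves.ModularForms.ModularParametrizationData W (W.conductorNorm ℤ)) (β : ℤ) (ι : K →+* ℂ) (M : ℕ), 1 ≤ M → ∀ (m l : ℕ), Squarefree (m * l) → l.Prime → ¬ l ∣ m → (∀ l' ∈ (m * l).primeFactors,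 Literature.NumberTheory.EllipticCurves.Zhang2014.IsKolyvaginPrime (W.conductorNorm ℤ) W K 2 l' ∧ M ≤ Literature.NumberTheory.EllipticCurves.Zhang2014.kolyvaginIndex W 2 l') → ∀ (d : Literature.NumberTheory.EllipticCurves.KolyvaginHeegnerData Dt β ι m) (d' : Literature.NumberTheory.EllipticCurves.KolyvaginHeegnerData Dt β ι (m * l)), (∀ l' ∈ m.primeFactors, ∀ (x : Literature.NumberTheory.EllipticCurves.ringClassField K ι m) (x' : Literature.NumberTheory.EllipticCurves.ringClassField K ι (m * l)), (x : ℂ) = x' → ((d'.σ l' x' : Literature.NumberTheory.EllipticCurves.ringClassField K ι (m * l)) : ℂ) = (d.σ l' x : ℂ)) → (∀ s ∈ d.S, ∃ s' ∈ d'.S, ∀ (x : Literature.NumberTheory.EllipticCurves.ringClassField K ι m) (x' : Literature.NumberTheory.EllipticCurves.ringClassField K ι (m * l)), (x : ℂ) = x' → ((s' x' : Literature.NumberTheory.EllipticCurves.ringClassField K ι (m * l)) : ℂ) = (s x : ℂ)) → (∀ s' ∈ d'.S, ∃ s ∈ d.S, ∀ (x : Literature.NumberTheory.EllipticCurves.ringClassField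 K ι m) (x' : Literature.NumberTheory.EllipticCurves.ringClassField K ι (m * l)), (x : ℂ) = x' → ((s' x' : Literature.NumberTheory.EllipticCurves.ringClassField K ι (m * l)) : ℂ) = (s x : ℂ)) → (∀ (x : Literature.NumberTheory.EllipticCurves.ringClassField K ι m) (x' : Literature.NumberTheory.EllipticCurves.ringClassField K ι (m * l)), (x : ℂ) = x' → d'.emb x' = d.emb x) → ∀ (v : IsDedekindDomain.HeightOneSpectrum (NumberField.RingOfIntegers K)), (l : NumberField.RingOfIntegers K) ∈ v.asIdeal → ∀ (j : ℕ), (((2 ^ j : ℕ) : ℤ) • d'.kolyvaginClass Nat.prime_two M ∈ WeierstrassCurve.selmerLocalKer (W.baseChange K) (v.adicCompletion K) ((2 ^ M : ℕ) : ℤ) ↔ ((2 ^ j : ℕ) : ℤ) • d'.kolyvaginClass Nat.prime_two M ∈ (W.baseChange K).torsionLocalKer (v.adicCompletion K) ((2 ^ M : ℕ) : ℤ)))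
    (h₂ : ∀ (W : WeierstrassCurve ℚ) [W.IsElliptic] [W.IsGloballyMinimal] [NeZero (W.conductorNorm ℤ)], ¬ W.HasCM → ∀ (K : Type) [Field K] [NumberField K], Literature.NumberTheory.EllipticCurves.IsImaginaryQuadratic K → NumberField.discr K ≠ -3 → NumberField.discr K ≠ -4 → Literature.NumberTheory.EllipticCurves.SatisfiesHeegnerHypothesis (W.conductorNorm ℤ) K → (∀ n : ℕ, W.HasSurjectiveModNGaloisRep (2 ^ n : ℕ)) → ∀ (Dt : Literature.NumberTheory.EllipticCurves.ModularForms.ModularParametrizationData W (W.conductorNorm ℤ)) (β : ℤ) (ι : K →+* ℂ) (M : ℕ), 1 ≤ M → ∀ (m l : ℕ), Squarefree (m * l) → l.Prime → ¬ l ∣ m → (∀ l' ∈ (m * l).primeFactors, Literature.NumberTheory.EllipticCurves.Zhang2014.IsKolyvaginPrime (W.conductorNorm ℤ) W K 2 l' ∧ M ≤ Literature.NumberTheory.EllipticCurves.Zhang2014.kolyvaginIndex W 2 l') → ∀ (d : Literature.NumberTheory.EllipticCurves.KolyvaginHeegnerData Dt β ι m) (d' : Literature.NumberTheory.EllipticCurves.KolyvaginHeegnerData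 Dt β ι (m * l)), (∀ l' ∈ m.primeFactors, ∀ (x : Literature.NumberTheory.EllipticCurves.ringClassField K ι m) (x' : Literature.NumberTheory.EllipticCurves.ringClassField K ι (m * l)), (x : ℂ) = x' → ((d'.σ l' x' : Literature.NumberTheory.EllipticCurves.ringClassField K ι (m * l)) : ℂ) = (d.σ l' x : ℂ)) → (∀ s ∈ d.S, ∃ s' ∈ d'.S, ∀ (x : Literature.NumberTheory.EllipticCurves.ringClassField K ι m) (x' : Literature.NumberTheory.EllipticCurves.ringClassField K ι (m * l)), (x : ℂ) = x' → ((s' x' : Literature.NumberTheory.EllipticCurves.ringClassField K ι (m * l)) : ℂ) = (s x : ℂ)) → (∀ s' ∈ d'.S, ∃ s ∈ d.S, ∀ (x : Literature.NumberTheory.EllipticCurves.ringClassField K ι m) (x' : Literature.NumberTheory.EllipticCurves.ringClassField K ι (m * l)), (x : ℂ) = x' → ((s' x' : Literature.NumberTheory.EllipticCurves.ringClassField K ι (m * l)) : ℂ) = (s x : ℂ)) → (∀ (x : Literature.NumberTheory.EllipticCurves.ringClassField K ι m) (x' : Literature.NumberTheory.EllipticCurves.ringClassField K ι (m * l)), (x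 : ℂ) = x' → d'.emb x' = d.emb x) → ∀ (v : IsDedekindDomain.HeightOneSpectrum (NumberField.RingOfIntegers K)), (l : NumberField.RingOfIntegers K) ∈ v.asIdeal → ∀ (j : ℕ), (((2 ^ j : ℕ) : ℤ) • d'.kolyvaginClass Nat.prime_two M ∈ (W.baseChange K).torsionLocalKer (v.adicCompletion K) ((2 ^ M : ℕ) : ℤ) ↔ ((2 ^ j : ℕ) : ℤ) • d.kolyvaginClass Nat.prime_two M ∈ (W.baseChange K).torsionLocalKer (v.adicCompletion K) ((2 ^ M : ℕ) : ℤ))) :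
    KolyvaginRelationAtTwo := by
  intro W _ _ _ hcm K _ _ hK hD3 hD4 hH hρ Dt β ι M hM m l hsq hl hlm hS d d' hσ hS₁ hS₂ hemb v hv j
  exact ⟨h₁ W hcm K hK hD3 hD4 hH hρ Dt β ι M hM m l hsq hl hlm hS d d' hσ hS₁ hS₂ hemb v hv j,
    h₂ W hcm K hK hD3 hD4 hH hρ Dt β ι M hM m l hsq hl hlm hS d d' hσ hS₁ hS₂ hemb v hv j⟩

/-- **The registered `stub_selmerVsTorsionAtEll` is the FIRST conjunct of Q2** (`ord_λ d_M(mℓ) = ord_λ c_M(mℓ)`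
in membership form): Q2 gives it back verbatim. [cite: McCallumLMS1991, §4 Prop. 4.4 «in particular»] -/
theorem stubSelmerVsTorsionAtEll_of_kolyvaginRelationAtTwo (h : KolyvaginRelationAtTwo) :
    ∀ (W : WeierstrassCurve ℚ) [W.IsElliptic] [W.IsGloballyMinimal] [NeZero (W.conductorNorm ℤ)], ¬ W.HasCM → ∀ (K : Type) [Field K] [NumberField K], Literature.NumberTheory.EllipticCurves.IsImaginaryQuadratic K → NumberField.discr K ≠ -3 → NumberField.discr K ≠ -4 → Literature.NumberTheory.EllipticCurves.SatisfiesHeegnerHypothesis (W.conductorNorm ℤ) K → (∀ n : ℕ, W.HasSurjectiveModNGaloisRep (2 ^ n : ℕ)) → ∀ (Dt : Literature.NumberTheory.EllipticCurves.ModularForms.ModularParametrizationData W (W.conductorNorm ℤ)) (β : ℤ) (ι : K →+* ℂ) (M : ℕ), 1 ≤ M → ∀ (m l : ℕ), Squarefree (m * l) → l.Prime → ¬ l ∣ m → (∀ l' ∈ (m * l).primeFactors, Literature.NumberTheory.EllipticCurves.Zhang2014.IsKolyvaginPrime (W.conductorNorm ℤ) W K 2 l' ∧ M ≤ Literature.NumberTheory.EllipticCurves.Zhang2014.kolyvaginIndex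 W 2 l') → ∀ (d : Literature.NumberTheory.EllipticCurves.KolyvaginHeegnerData Dt β ι m) (d' : Literature.NumberTheory.EllipticCurves.KolyvaginHeegnerData Dt β ι (m * l)), (∀ l' ∈ m.primeFactors, ∀ (x : Literature.NumberTheory.EllipticCurves.ringClassField K ι m) (x' : Literature.NumberTheory.EllipticCurves.ringClassField K ι (m * l)), (x : ℂ) = x' → ((d'.σ l' x' : Literature.NumberTheory.EllipticCurves.ringClassField K ι (m * l)) : ℂ) = (d.σ l' x : ℂ)) → (∀ s ∈ d.S, ∃ s' ∈ d'.S, ∀ (x : Literature.NumberTheory.EllipticCurves.ringClassField K ι m) (x' : Literature.NumberTheory.EllipticCurves.ringClassField K ι (m * l)), (x : ℂ) = x' → ((s' x' : Literature.NumberTheory.EllipticCurves.ringClassField K ι (m * l)) : ℂ) = (s x : ℂ)) → (∀ s' ∈ d'.S, ∃ s ∈ d.S, ∀ (x : Literature.NumberTheory.EllipticCurves.ringClassField K ι m) (x' : Literature.NumberTheory.EllipticCurves.ringClassField K ι (m * l)), (x : ℂ) = x' → ((s' x' : Literature.NumberTheory.EllipticCurves.ringClassField K ι (m * l)) : ℂ)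 = (s x : ℂ)) → (∀ (x : Literature.NumberTheory.EllipticCurves.ringClassField K ι m) (x' : Literature.NumberTheory.EllipticCurves.ringClassField K ι (m * l)), (x : ℂ) = x' → d'.emb x' = d.emb x) → ∀ (v : IsDedekindDomain.HeightOneSpectrum (NumberField.RingOfIntegers K)), (l : NumberField.RingOfIntegers K) ∈ v.asIdeal → ∀ (j : ℕ), (((2 ^ j : ℕ) : ℤ) • d'.kolyvaginClass Nat.prime_two M ∈ WeierstrassCurve.selmerLocalKer (W.baseChange K) (v.adicCompletion K) ((2 ^ M : ℕ) : ℤ) ↔ ((2 ^ j : ℕ) : ℤ) • d'.kolyvaginClass Nat.prime_two M ∈ (W.baseChange K).torsionLocalKer (v.adicCompletion K) ((2 ^ M : ℕ) : ℤ)) := by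
  intro W _ _ _ hcm K _ _ hK hD3 hD4 hH hρ Dt β ι M hM m l hsq hl hlm hS d d' hσ hS₁ hS₂ hemb v hv j
  exact (h W hcm K hK hD3 hD4 hH hρ Dt β ι M hM m l hsq hl hlm hS d d' hσ hS₁ hS₂ hemb v hv j).1

/-- **The registered `stub_levelChange` is the SECOND conjunct of Q2** (`ord_λ c_M(mℓ) = ord_λ c_M(m)` in
membership form): Q2 gives it back verbatim. [cite: McCallumLMS1991, §4 Prop. 4.4 «in particular»] -/
theorem stubLevelChange_of_kolyvaginRelationAtTwo (h : KolyvaginRelationAtTwo) :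
    ∀ (W : WeierstrassCurve ℚ) [W.IsElliptic] [W.IsGloballyMinimal] [NeZero (W.conductorNorm ℤ)], ¬ W.HasCM → ∀ (K : Type) [Field K] [NumberField K], Literature.NumberTheory.EllipticCurves.IsImaginaryQuadratic K → NumberField.discr K ≠ -3 → NumberField.discr K ≠ -4 → Literature.NumberTheory.EllipticCurves.SatisfiesHeegnerHypothesis (W.conductorNorm ℤ) K → (∀ n : ℕ, W.HasSurjectiveModNGaloisRep (2 ^ n : ℕ)) → ∀ (Dt : Literature.NumberTheory.EllipticCurves.ModularForms.ModularParametrizationData W (W.conductorNorm ℤ)) (β : ℤ) (ι : K →+* ℂ) (M : ℕ), 1 ≤ M → ∀ (m l : ℕ), Squarefree (m * l) → l.Prime → ¬ l ∣ m → (∀ l' ∈ (m * l).primeFactors, Literature.NumberTheory.EllipticCurves.Zhang2014.IsKolyvaginPrime (W.conductorNorm ℤ) W K 2 l' ∧ M ≤ Literature.NumberTheory.EllipticCurves.Zhang2014.kolyvaginIndex W 2 l') → ∀ (d : Literature.NumberTheory.EllipticCurves.KolyvaginHeegnerData Dt β ι m) (d' : Literature.NumberTheory.EllipticCurves.KolyvaginHeegnerData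 Dt β ι (m * l)), (∀ l' ∈ m.primeFactors, ∀ (x : Literature.NumberTheory.EllipticCurves.ringClassField K ι m) (x' : Literature.NumberTheory.EllipticCurves.ringClassField K ι (m * l)), (x : ℂ) = x' → ((d'.σ l' x' : Literature.NumberTheory.EllipticCurves.ringClassField K ι (m * l)) : ℂ) = (d.σ l' x : ℂ)) → (∀ s ∈ d.S, ∃ s' ∈ d'.S, ∀ (x : Literature.NumberTheory.EllipticCurves.ringClassField K ι m) (x' : Literature.NumberTheory.EllipticCurves.ringClassField K ι (m * l)), (x : ℂ) = x' → ((s' x' : Literature.NumberTheory.EllipticCurves.ringClassField K ι (m * l)) : ℂ) = (s x : ℂ)) → (∀ s' ∈ d'.S, ∃ s ∈ d.S, ∀ (x : Literature.NumberTheory.EllipticCurves.ringClassField K ι m) (x' : Literature.NumberTheory.EllipticCurves.ringClassField K ι (m * l)), (x : ℂ) = x' → ((s' x' : Literature.NumberTheory.EllipticCurves.ringClassField K ι (m * l)) : ℂ) = (s x : ℂ)) → (∀ (x : Literature.NumberTheory.EllipticCurves.ringClassField K ι m) (x' : Literature.NumberTheory.EllipticCurves.ringClassField K ι (m * l)), (x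 : ℂ) = x' → d'.emb x' = d.emb x) → ∀ (v : IsDedekindDomain.HeightOneSpectrum (NumberField.RingOfIntegers K)), (l : NumberField.RingOfIntegers K) ∈ v.asIdeal → ∀ (j : ℕ), (((2 ^ j : ℕ) : ℤ) • d'.kolyvaginClass Nat.prime_two M ∈ (W.baseChange K).torsionLocalKer (v.adicCompletion K) ((2 ^ M : ℕ) : ℤ) ↔ ((2 ^ j : ℕ) : ℤ) • d.kolyvaginClass Nat.prime_two M ∈ (W.baseChange K).torsionLocalKer (v.adicCompletion K) ((2 ^ M : ℕ) : ℤ)) := by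
  intro W _ _ _ hcm K _ _ hK hD3 hD4 hH hρ Dt β ι M hM m l hsq hl hlm hS d d' hσ hS₁ hS₂ hemb v hv j
  exact (h W hcm K hK hD3 hD4 hH hρ Dt β ι M hM m l hsq hl hlm hS d d' hσ hS₁ hS₂ hemb v hv j).2

/-- **`stub_selmerVsTorsionAtEll` BY NAME modulo the one print fact** `GrossLMS1991.prop37_2_frobeniusCongruence`
(Gross 1991 Prop. 3.7 (2) = Nekovář 2007 Prop. 4.9), via gk2-p2's conditional closer of Q2. CONDITIONAL on that
named fact; nothing else. [cite: GrossLMS1991, Prop. 3.7 (2) (p. 240)] [cite: Nekovar2007, Prop. 4.9] -/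
theorem stubSelmerVsTorsionAtEll_of_frobeniusCongruence (h : prop37_2_frobeniusCongruence) :
    ∀ (W : WeierstrassCurve ℚ) [W.IsElliptic] [W.IsGloballyMinimal] [NeZero (W.conductorNorm ℤ)], ¬ W.HasCM → ∀ (K : Type) [Field K] [NumberField K], Literature.NumberTheory.EllipticCurves.IsImaginaryQuadratic K → NumberField.discr K ≠ -3 → NumberField.discr K ≠ -4 → Literature.NumberTheory.EllipticCurves.SatisfiesHeegnerHypothesis (W.conductorNorm ℤ) K → (∀ n : ℕ, W.HasSurjectiveModNGaloisRep (2 ^ n : ℕ)) → ∀ (Dt : Literature.NumberTheory.EllipticCurves.ModularForms.ModularParametrizationData W (W.conductorNorm ℤ)) (β : ℤ) (ι : K →+* ℂ) (M : ℕ), 1 ≤ M → ∀ (m l : ℕ), Squarefree (m * l) → l.Prime → ¬ l ∣ m → (∀ l' ∈ (m * l).primeFactors, Literature.NumberTheory.EllipticCurves.Zhang2014.IsKolyvaginPrime (W.conductorNorm ℤ) W K 2 l' ∧ M ≤ Literature.NumberTheory.EllipticCurves.Zhang2014.kolyvaginIndex W 2 l') → ∀ (d : Literature.NumberTheory.EllipticCurves.KolyvaginHeegnerData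 Dt β ι m) (d' : Literature.NumberTheory.EllipticCurves.KolyvaginHeegnerData Dt β ι (m * l)), (∀ l' ∈ m.primeFactors, ∀ (x : Literature.NumberTheory.EllipticCurves.ringClassField K ι m) (x' : Literature.NumberTheory.EllipticCurves.ringClassField K ι (m * l)), (x : ℂ) = x' → ((d'.σ l' x' : Literature.NumberTheory.EllipticCurves.ringClassField K ι (m * l)) : ℂ) = (d.σ l' x : ℂ)) → (∀ s ∈ d.S, ∃ s' ∈ d'.S, ∀ (x : Literature.NumberTheory.EllipticCurves.ringClassField K ι m) (x' : Literature.NumberTheory.EllipticCurves.ringClassField K ι (m * l)), (x : ℂ) = x' → ((s' x' : Literature.NumberTheory.EllipticCurves.ringClassField K ι (m * l)) : ℂ) = (s x : ℂ)) → (∀ s' ∈ d'.S, ∃ s ∈ d.S, ∀ (x : Literature.NumberTheory.EllipticCurves.ringClassField K ι m) (x' : Literature.NumberTheory.EllipticCurves.ringClassField K ι (m * l)), (x : ℂ) = x' → ((s' x' : Literature.NumberTheory.EllipticCurves.ringClassField K ι (m * l)) : ℂ) = (s x : ℂ)) → (∀ (x : Literature.NumberTheory.EllipticCurves.ringClassField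 K ι m) (x' : Literature.NumberTheory.EllipticCurves.ringClassField K ι (m * l)), (x : ℂ) = x' → d'.emb x' = d.emb x) → ∀ (v : IsDedekindDomain.HeightOneSpectrum (NumberField.RingOfIntegers K)), (l : NumberField.RingOfIntegers K) ∈ v.asIdeal → ∀ (j : ℕ), (((2 ^ j : ℕ) : ℤ) • d'.kolyvaginClass Nat.prime_two M ∈ WeierstrassCurve.selmerLocalKer (W.baseChange K) (v.adicCompletion K) ((2 ^ M : ℕ) : ℤ) ↔ ((2 ^ j : ℕ) : ℤ) • d'.kolyvaginClass Nat.prime_two M ∈ (W.baseChange K).torsionLocalKer (v.adicCompletion K) ((2 ^ M : ℕ) : ℤ)) :=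
  stubSelmerVsTorsionAtEll_of_kolyvaginRelationAtTwo (kolyvaginRelationAtTwo_of_frobeniusCongruence h)

/-- **`stub_levelChange` BY NAME modulo the one print fact** `GrossLMS1991.prop37_2_frobeniusCongruence`
(Gross 1991 Prop. 3.7 (2) = Nekovář 2007 Prop. 4.9), via gk2-p2's conditional closer of Q2. CONDITIONAL on that
named fact; nothing else. [cite: GrossLMS1991, Prop. 3.7 (2) (p. 240)] [cite: Nekovar2007, Prop. 4.9] -/
theorem stubLevelChange_of_frobeniusCongruence (h : prop37_2_frobeniusCongruence) :
    ∀ (W : WeierstrassCurve ℚ) [W.IsElliptic] [W.IsGloballyMinimal] [NeZero (W.conductorNorm ℤ)], ¬ W.HasCM → ∀ (K : Type) [Field K] [NumberField K], Literature.NumberTheory.EllipticCurves.IsImaginaryQuadratic K → NumberField.discr K ≠ -3 → NumberField.discr K ≠ -4 → Literature.NumberTheory.EllipticCurves.SatisfiesHeegnerHypothesis (W.conductorNorm ℤ) K → (∀ n : ℕ, W.HasSurjectiveModNGaloisRep (2 ^ n : ℕ)) → ∀ (Dt : Literature.NumberTheory.EllipticCurves.ModularForms.ModularParametrizationData W (W.conductorNorm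 ℤ)) (β : ℤ) (ι : K →+* ℂ) (M : ℕ), 1 ≤ M → ∀ (m l : ℕ), Squarefree (m * l) → l.Prime → ¬ l ∣ m → (∀ l' ∈ (m * l).primeFactors, Literature.NumberTheory.EllipticCurves.Zhang2014.IsKolyvaginPrime (W.conductorNorm ℤ) W K 2 l' ∧ M ≤ Literature.NumberTheory.EllipticCurves.Zhang2014.kolyvaginIndex W 2 l') → ∀ (d : Literature.NumberTheory.EllipticCurves.KolyvaginHeegnerData Dt β ι m) (d' : Literature.NumberTheory.EllipticCurves.KolyvaginHeegnerData Dt β ι (m * l)), (∀ l' ∈ m.primeFactors, ∀ (x : Literature.NumberTheory.EllipticCurves.ringClassField K ι m) (x' : Literature.NumberTheory.EllipticCurves.ringClassField K ι (m * l)), (x : ℂ) = x' → ((d'.σ l' x' : Literature.NumberTheory.EllipticCurves.ringClassField K ι (m * l)) : ℂ) = (d.σ l' x : ℂ)) → (∀ s ∈ d.S, ∃ s' ∈ d'.S, ∀ (x : Literature.NumberTheory.EllipticCurves.ringClassField K ι m) (x' : Literature.NumberTheory.EllipticCurves.ringClassField K ι (m * l)), (x : ℂ) = x' → ((s' x' :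 Literature.NumberTheory.EllipticCurves.ringClassField K ι (m * l)) : ℂ) = (s x : ℂ)) → (∀ s' ∈ d'.S, ∃ s ∈ d.S, ∀ (x : Literature.NumberTheory.EllipticCurves.ringClassField K ι m) (x' : Literature.NumberTheory.EllipticCurves.ringClassField K ι (m * l)), (x : ℂ) = x' → ((s' x' : Literature.NumberTheory.EllipticCurves.ringClassField K ι (m * l)) : ℂ) = (s x : ℂ)) → (∀ (x : Literature.NumberTheory.EllipticCurves.ringClassField K ι m) (x' : Literature.NumberTheory.EllipticCurves.ringClassField K ι (m * l)), (x : ℂ) = x' → d'.emb x' = d.emb x) → ∀ (v : IsDedekindDomain.HeightOneSpectrum (NumberField.RingOfIntegers K)), (l : NumberField.RingOfIntegers K) ∈ v.asIdeal → ∀ (j : ℕ), (((2 ^ j : ℕ) : ℤ) • d'.kolyvaginClass Nat.prime_two M ∈ (W.baseChange K).torsionLocalKer (v.adicCompletion K) ((2 ^ M : ℕ) : ℤ) ↔ ((2 ^ j : ℕ) : ℤ) • d.kolyvaginClass Nat.prime_two M ∈ (W.baseChange K).torsionLocalKer (v.adicCompletion K) ((2 ^ M : ℕ) : ℤ)) 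:=
  stubLevelChange_of_kolyvaginRelationAtTwo (kolyvaginRelationAtTwo_of_frobeniusCongruence h)

end Summit.BirchSwinnertonDyer.BirchSwinnertonDyer.Theorems.GenusExact.KolyvaginRelationAtTwoStubs
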